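import Summits.CriticalPhenomena.PercolationContinuityZ3.Theorems.FK.Transplant.KNFreeRunReach
import Summits.CriticalPhenomena.PercolationContinuityZ3.Theorems.FK.ContinuityCruxDefs
import HarnessLib

/-!
# FK-continuity transplant, FT-07 (e): Kozma–Nitzan's scheme as an `FKScheme`, robustly lawful from `UFSC0`
# (all fields of `FKRobustLawful` except soundness; soundness and C3b `FKLawfulOfCriterion` are part (f))

Cell `fk-continuity` (bschramm), FRONTIER TRANSPLANT sub-cell, row FT-07 (`KNFreeTheorem6`); support file
(`--supports stmt-CriticalPhenomena-4575`); builds on p205010 (kernel theorem, internal audit signed; external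
expert review pending). HONEST FRAMING: the transplant this file serves is CONDITIONAL on the free-boundary
penetration hypothesis FH (open at the same `p` for `q > 1`; ⇔ GRC Conj. (5.103) via K1; barrier note
`Literature.Barriers.CriticalPhenomena.SamePFreeBoundaryCriteria`); a typed reduction, not a proof of FK continuity.
THIS file is unconditional: no named facts, no sorries, standard axioms; `FH` does not occur in it.

## What is here

FO-05 (`ContinuityCruxDefs.lean`) types C1 `FKRobustLawful d q p ε N E` for an `FKScheme d` and C3b
`FKLawfulOfCriterion d q : UFSC0 d q p r ε₀ → ∃ N E, FKRobustLawful d q p (4ε₀) N E ∧ E.Sound`. Here: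

* `knScheme S q : FKScheme d` — Kozma–Nitzan's FK exploration process `schemeFK S q` (FT-06a) with onward
  directions `S.onward h (tgt e)`, regions `S.Sx`, bad events `badFK S q` (so `E.law q S.p = fkLaw (Sx) (Wfull) q`,
  FO-05 `law_eq_fkLaw_Wfull`);
* the `FKRobustLawful` fields for it: `fresh`, `probes` (every chosen history is FK-valid, FT-07 (c)
  `RunFK.validFK_of_choice`, so a probe is made), `cover` (FT-06a `not_succFK_subset`), `lower` (FT-06
  `isLowerSet_badFK` with FT-06d `isPinningLaw_fkLaw`), `determined` (FT-06 `determinedBy_badFK`), `freshCard`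
  (`knFreshBound S`: the fresh lattice edges of `Sx` touch `E_{w,v} ∪ E_{v,x} ⊆` three cells), `fail` (the `≤ 4`
  per-direction `UFSC0` bounds);
* `ufsc0_nonneg` — a `UFSC0`-type failure clause forces `0 ≤ ε₀` (the empty history with the first candidate is
  FK-valid and has an onward direction; fk-ref R-g10-1);
* `fkRobustLawful_knScheme` — **`FKRobustLawful d q S.p (4ε₀) (knFreshBound S) (knScheme S q)`** from the two
  clauses of `UFSC0` for `S` (`1 ≤ q`).

## References

* G. Kozma, S. Nitzan, arXiv:2401.12397 (2024), §4 pp. 25–31 ((28)–(33)). [KozmaNitzan2024]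
* G. Grimmett, *The Random-Cluster Model*, Springer 2006: Thm. (3.7), eq. (3.22). [Grimmett2006]
-/

noncomputable section

open MeasureTheory Finset
open scoped ENNReal Classical

namespace Summit.CriticalPhenomena.PercolationContinuityZ3.Theorems.FK

open Literature.Probability.Percolation Literature.Probability.LatticeModels SimpleGraph
open Literature.Probability.Percolation.GadgetSystem Literature.Probability.Percolation.KozmaNitzan
open ProbeHistory HSiteScheme KSch Cells Transplant

variable {d : ℕ} (S : KSch d) (q : ℝ)

/-- **Kozma–Nitzan's scheme as an FK history scheme** (FO-05 `FKScheme`): the FK exploration process with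
onward directions `X_v`, regions `E_i ∪ E_{w,v} ∪ E_{v,x}` and bad events "good at no level".
[cite: KozmaNitzan2024, §4 pp. 26–27] -/
def knScheme : FKScheme d where
  toHSiteScheme := schemeFK S q
  dirs := fun h e => S.onward h (tgt e)
  reg := S.Sx
  bad := badFK S q

/-- The initial edges of `knScheme` are KN's `U₀`. [folklore] -/
theorem knScheme_U₀ : (knScheme S q).U₀ = S.U₀ := rfl

/-- The revealed set of `knScheme` is KN's `F`. [folklore] -/
theorem knScheme_revealed (h : ProbeHistory (Site d)) : (knScheme S q).revealed h = S.F h := rfl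

/-- The minimal law of `knScheme` at the scheme's own parameter is `P^x = fkLaw (Sx) (Wfull) q`. [folklore] -/
theorem knScheme_law (h : ProbeHistory (Site d)) (e : Site 2 × MDir) (du : MDir) :
    (knScheme S q).law q S.p h e du = fkLaw (S.Sx h e du) (S.Wfull h e du) q :=
  FKScheme.law_eq_fkLaw_Wfull _ S rfl rfl q h e du

/-- **A uniform bound on the fresh lattice edges of a region**: `2d` times three cells. [folklore] -/
def knFreshBound : ℕ := 2 * d * (3 * (S.C.Cell 0).card)

variable {S q}

/-! ### Geometry of the fresh edges -/

/-- All cells have the same number of vertices. [folklore] -/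
theorem card_Cell (u : Site 2) : (S.C.Cell u).card = (S.C.Cell 0).card := by
  unfold Cells.Cell
  rw [Pi.card_Icc, Pi.card_Icc]
  refine Finset.prod_congr rfl fun j _ => ?_
  rw [Int.card_Icc, Int.card_Icc]
  congr 1
  simp only [Pi.add_apply, Pi.sub_apply]
  ring

/-- After an FK-valid history, a fresh lattice edge of `Sx` has an endpoint in one of the three cells
`Cell w`, `Cell v`, `Cell x`. [cite: KozmaNitzan2024, §4 p. 27] -/
theorem exists_mem_cells_of_mem_fresh {h : ProbeHistory (Site d)} {e : Site 2 × MDir} (hV : ValidFK S q h e)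
    {du : MDir} {x : Sym2 (Site d)} (hx : x ∈ (knScheme S q).fresh h (S.Sx h e du)) :
    ∃ a ∈ x, a ∈ S.C.Cell e.1 ∪ S.C.Cell (tgt e) ∪ S.C.Cell (tgt e + stepVec du) := by
  rw [FKScheme.fresh, knScheme_revealed, Finset.mem_sdiff, mem_edgesIn_iff, hV.F_eq, mem_edgesIn_iff] at hx
  obtain ⟨⟨hxE, hxS⟩, hxV⟩ := hx
  push Not at hxV
  obtain ⟨a, ha, haV⟩ := hxV hxE
  refine ⟨a, ha, ?_⟩
  rcases Finset.mem_union.1 (hxS a ha) with h1 | h1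
  · rcases Finset.mem_union.1 h1 with h2 | h2
    · exact absurd h2 haV
    · rcases Finset.mem_union.1 (S.C.Ewv_subset_Cells _ _ h2) with h3 | h3
      · exact Finset.mem_union_left _ (Finset.mem_union_left _ h3)
      · exact Finset.mem_union_left _ (Finset.mem_union_right _ h3)
  · rcases Finset.mem_union.1 (S.C.Ewv_subset_Cells _ _ (S.C.Efar_subset_Ewv _ _ h1)) with h3 | h3
    · exact Finset.mem_union_left _ (Finset.mem_union_right _ h3)
    · exact Finset.mem_union_right _ h3

/-- **The fresh-edge bound**: after an FK-valid history, every region `Sx` has at most `knFreshBound S` fresh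
lattice edges. [folklore] -/
theorem card_fresh_le_knFreshBound {h : ProbeHistory (Site d)} {e : Site 2 × MDir} (hV : ValidFK S q h e) (du : MDir) :
    ((knScheme S q).fresh h (S.Sx h e du)).card ≤ knFreshBound S := by
  set CU : Finset (Site d) := S.C.Cell e.1 ∪ S.C.Cell (tgt e) ∪ S.C.Cell (tgt e + stepVec du) with hCU
  set Sg : Finset ℤ := {1, -1} with hSg
  set f : Site d × (Fin d × ℤ) → Sym2 (Site d) := fun t => s(t.1, t.1 + t.2.2 • unitVec t.2.1) with hf
  have hsub : (knScheme S q).fresh h (S.Sx h e du) ⊆ (CU ×ˢ ((Finset.univ : Finset (Fin d)) ×ˢ Sg)).image f := by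
    intro x hx
    obtain ⟨a, hax, haC⟩ := exists_mem_cells_of_mem_fresh hV hx
    rw [FKScheme.fresh, Finset.mem_sdiff, mem_edgesIn_iff] at hx
    have hxE := hx.1.1
    -- write `x = s(a, b)` with `b` a lattice neighbour of `a`
    obtain ⟨b, hb⟩ : ∃ b, x = s(a, b) := by
      induction x using Sym2.ind with
      | h u v =>
        rcases Sym2.mem_iff.1 hax with rfl | rfl
        · exact ⟨v, rfl⟩
        · exact ⟨u, Sym2.eq_swap⟩
    subst hb
    have hadj : (zdGraph d).Adj a b := (SimpleGraph.mem_edgeSet _).1 hxE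
    obtain ⟨i, σ, hσ, rfl⟩ := adj_iff_exists_sign.1 hadj
    refine Finset.mem_image.2 ⟨(a, (i, σ)), ?_, rfl⟩
    refine Finset.mem_product.2 ⟨haC, Finset.mem_product.2 ⟨Finset.mem_univ _, ?_⟩⟩
    rcases hσ with rfl | rfl <;> simp [hSg]
  calc ((knScheme S q).fresh h (S.Sx h e du)).card
      ≤ ((CU ×ˢ ((Finset.univ : Finset (Fin d)) ×ˢ Sg)).image f).card := Finset.card_le_card hsub
    _ ≤ (CU ×ˢ ((Finset.univ : Finset (Fin d)) ×ˢ Sg)).card := Finset.card_image_le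
    _ = CU.card * (d * Sg.card) := by rw [Finset.card_product, Finset.card_product, Finset.card_univ, Fintype.card_fin]
    _ ≤ (3 * (S.C.Cell 0).card) * (d * 2) := by
        refine Nat.mul_le_mul ?_ (Nat.mul_le_mul le_rfl ?_)
        · calc CU.card ≤ (S.C.Cell e.1 ∪ S.C.Cell (tgt e)).card + (S.C.Cell (tgt e + stepVec du)).card :=
                Finset.card_union_le _ _
            _ ≤ ((S.C.Cell e.1).card + (S.C.Cell (tgt e)).card) + (S.C.Cell (tgt e + stepVec du)).card :=
                Nat.add_le_add_right (Finset.card_union_le _ _) _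
            _ = 3 * (S.C.Cell 0).card := by
                rw [card_Cell e.1, card_Cell (tgt e), card_Cell (tgt e + stepVec du)]; ring
        · rw [hSg]; exact (Finset.card_insert_le _ _).trans (by simp)
    _ = knFreshBound S := by unfold knFreshBound; ring

/-! ### The fields of `FKRobustLawful` -/

/-- The probes of the FK scheme examine fresh edges: their envelopes avoid `U₀` and the examined edges.
[cite: KozmaNitzan2024, §4 p. 27] -/
theorem knScheme_fresh : (knScheme S q).E.Fresh (↑(knScheme S q).U₀ : Set (Sym2 (Site d))) := by
  intro h P hP
  obtain ⟨e, -, -, rfl⟩ := nextProbeFK_eq_some (S := S) (q := q) hP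
  constructor
  · rw [Set.disjoint_left]
    intro x hx hxU
    exact (Finset.mem_sdiff.1 (Finset.mem_coe.1 hx)).2 (S.U₀_subset_F _ (Finset.mem_coe.1 hxU))
  · rw [Finset.disjoint_left]
    intro x hx hxs
    exact (Finset.mem_sdiff.1 hx).2 (Finset.mem_union_right _ hxs)

/-- Given (32)-FK at the origin, the FK scheme probes whenever a candidate exists (every chosen history is
FK-valid, FT-07 (c)). [cite: KozmaNitzan2024, §4 pp. 26–28] -/
theorem knScheme_probes (hq : 1 ≤ q) (hQ0 : ∀ du : MDir, OriginFK S q du) (ω : BondConfig (Site d)) (n : ℕ)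
    (hc : ((knScheme S q).toHSiteScheme.stN n ω).choice ≠ none) :
    (knScheme S q).E.next ((knScheme S q).E.hist n ω) ≠ none := by
  obtain ⟨e, he⟩ := Option.ne_none_iff_exists'.1 hc
  have hV : ValidFK S q (RunFK.hst S q ω n) e := RunFK.validFK_of_choice hq hQ0 he
  show nextProbeFK S q (RunFK.hst S q ω n) ≠ none
  rw [nextProbeFK_of_validFK (h := RunFK.hst S q ω n) he hV]
  exact Option.some_ne_none _

/-- A failed examination has a bad onward direction (FT-06a `not_succFK_subset`). [cite: KozmaNitzan2024, §4 p. 27] -/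
theorem knScheme_cover (h : ProbeHistory (Site d)) (P : AProbe (Site d)) (e : Site 2 × MDir)
    (hP : (knScheme S q).E.next h = some P) (hc : ((knScheme S q).toHSiteScheme.mst h).choice = some e) :
    {ω | ¬(knScheme S q).succ h e (P.read ω)} ⊆ ⋃ du ∈ (knScheme S q).dirs h e, (knScheme S q).bad h e du := by
  obtain ⟨e', hc', -, rfl⟩ := nextProbeFK_eq_some (S := S) (q := q) hP
  have hee : e' = e := Option.some_injective _ (hc'.symm.trans hc)
  subst hee
  exact not_succFK_subset S q h e'

/-- Every bad event is decreasing (FT-06 `isLowerSet_badFK`, FT-06d `isPinningLaw_fkLaw`).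
[cite: Grimmett2006, eq. (3.22)] -/
theorem knScheme_lower (hq : 1 ≤ q) (h : ProbeHistory (Site d)) (e : Site 2 × MDir) (du : MDir) :
    IsLowerSet ((knScheme S q).bad h e du) :=
  isLowerSet_badFK (isPinningLaw_fkLaw (S.Sx h e du) hq)

/-- Every bad event is determined by the lattice edges of its region. [folklore] -/
theorem knScheme_determined (h : ProbeHistory (Site d)) (e : Site 2 × MDir) (du : MDir) :
    DeterminedBy ((knScheme S q).bad h e du) (↑(edgesIn (zdGraph d) ((knScheme S q).reg h e du)) : Set (Sym2 (Site d))) := by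
  refine (determinedBy_badFK (S := S) (q := q) h e du).mono (Finset.coe_subset.2 fun x hx => ?_)
  have hx' := (Finset.mem_sdiff.1 hx).1
  rw [KSch.Fj, mem_edgesIn_iff] at hx'
  rw [mem_edgesIn_iff]
  exact ⟨hx'.1, fun y hy => KSch.region_subset_Sx S h e du (by have := S.C.hK; omega) (hx'.2 y hy)⟩

/-- **`UFSC0`'s failure clause forces `0 ≤ ε₀`** (fk-ref R-g10-1): the empty history with the first candidate edge
is FK-valid (given (32)-FK at the origin) and has an onward direction, whose bad event has probability `≥ 0`.
[cite: KozmaNitzan2024, §4 p. 25 ((1), (3))] -/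
theorem ufsc0_nonneg (hq : 1 ≤ q) (hQ0 : ∀ du : MDir, OriginFK S q du) {ε₀ : ℝ}
    (hbad : ∀ (h : ProbeHistory (Site d)) (e : Site 2 × MDir) (du : MDir), ValidFK S q h e →
      du ∈ S.onward h (tgt e) → (fkLaw (S.Sx h e du) (S.Wfull h e du) q).real (badFK S q h e du) ≤ ε₀) :
    0 ≤ ε₀ := by
  -- the start state has a candidate: `(0, δ)` for any direction `δ`
  set δ₀ : MDir := (0, true) with hδ₀
  have hcand : HState.start.Cand ((0 : Site 2), δ₀) := by
    refine ⟨by simp [HState.start], ?_⟩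
    simp only [HState.Det, HState.start, Finset.mem_singleton, Finset.notMem_empty, or_false]
    intro h0
    have := congrArg (fun v : Site 2 => v δ₀.1) h0
    simp [tgt, hδ₀] at this
  have hch : HState.start.choice ≠ none := fun hnone => HState.not_cand_of_choice_eq_none hnone _ hcand
  obtain ⟨e₀, he₀⟩ := Option.ne_none_iff_exists'.1 hch
  have hc0 : ((schemeFK S q).stN 0 (∅ : BondConfig (Site d))).choice = some e₀ := he₀
  have hV : ValidFK S q (RunFK.hst S q (∅ : BondConfig (Site d)) 0) e₀ := RunFK.validFK_of_choice hq hQ0 hc0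
  have hV' : ValidFK S q [] e₀ := hV
  -- an onward direction of the target: the same direction again
  have hcand₀ := HState.cand_of_choice he₀
  have he1 : e₀.1 = 0 := by simpa [HState.start] using hcand₀.1
  have hdu : e₀.2 ∈ S.onward [] (tgt e₀) := by
    refine Finset.mem_filter.2 ⟨Finset.mem_univ _, fun hmem => ?_⟩
    rw [KSch.V_nil] at hmem
    have h0 : tgt e₀ + stepVec e₀.2 = 0 := S.C.eq_of_cen_mem_Cell (S.C.Q_subset_Cell 0 hmem)
    have := congrArg (fun v : Site 2 => v e₀.2.1) h0
    simp only [tgt, he1, Pi.add_apply, Pi.zero_apply, zero_add, stepVec_apply_fst] at this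
    rcases Cells.sgOf_sign e₀.2 with hs | hs <;> rw [hs] at this <;> norm_num at this
  exact le_trans measureReal_nonneg (hbad [] e₀ e₀.2 hV' hdu)

/-- **KN's FK scheme is robustly lawful at `(S.p, 4ε₀)`** from the two clauses of `UFSC0` for `S` (C3b, all of
`FKRobustLawful`; soundness is part (f)). [cite: KozmaNitzan2024, §4 pp. 25–31 ((28)–(33))] -/
theorem fkRobustLawful_knScheme (hq : 1 ≤ q) {ε₀ : ℝ} (hQ0 : ∀ du : MDir, OriginFK S q du)
    (hbad : ∀ (h : ProbeHistory (Site d)) (e : Site 2 × MDir) (du : MDir), ValidFK S q h e →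
      du ∈ S.onward h (tgt e) → (fkLaw (S.Sx h e du) (S.Wfull h e du) q).real (badFK S q h e du) ≤ ε₀) :
    FKRobustLawful d q S.p (4 * ε₀) (knFreshBound S) (knScheme S q) where
  fresh := knScheme_fresh
  probes ω _ n hc := knScheme_probes hq hQ0 ω n hc
  cover h P e hP hc := knScheme_cover h P e hP hc
  lower h e du := knScheme_lower hq h e du
  determined h e du := knScheme_determined h e du
  freshCard h P e hP hc du _ := by
    obtain ⟨e', hc', hV, -⟩ := nextProbeFK_eq_some (S := S) (q := q) hP
    have hee : e' = e := Option.some_injective _ (hc'.symm.trans hc)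
    subst hee
    exact card_fresh_le_knFreshBound hV du
  fail h P e hP hc := by
    obtain ⟨e', hc', hV, -⟩ := nextProbeFK_eq_some (S := S) (q := q) hP
    have hee : e' = e := Option.some_injective _ (hc'.symm.trans hc)
    subst hee
    have hε₀ : 0 ≤ ε₀ := ufsc0_nonneg hq hQ0 hbad
    have hcard : ((knScheme S q).dirs h e').card ≤ 4 := by
      have h1 : (S.onward h (tgt e')).card ≤ Fintype.card MDir := Finset.card_le_univ _
      have h2 : Fintype.card MDir = 4 := by simp [MDir, Fintype.card_prod, Fintype.card_bool, Fintype.card_fin]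
      show (S.onward h (tgt e')).card ≤ 4
      omega
    calc ∑ du ∈ (knScheme S q).dirs h e', ((knScheme S q).law q S.p h e' du).real ((knScheme S q).bad h e' du)
        ≤ ∑ du ∈ (knScheme S q).dirs h e', ε₀ := by
          refine Finset.sum_le_sum fun du hdu => ?_
          rw [knScheme_law]
          exact hbad h e' du hV hdu
      _ = ((knScheme S q).dirs h e').card * ε₀ := by rw [Finset.sum_const, nsmul_eq_mul]
      _ ≤ 4 * ε₀ := mul_le_mul_of_nonneg_right (by exact_mod_cast hcard) hε₀

end Summit.CriticalPhenomena.PercolationContinuityZ3.Theorems.FK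

end
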